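import Mathlib
import Summits.NavierStokesRegularity.NavierStokesRegularity.Theorems.FilamentSkeletonRssClause13ModelGluing
import Summits.NavierStokesRegularity.NavierStokesRegularity.Theorems.FilamentSkeletonRssClause13KernelProfileFacts

/-!
# Clause 13-J/13-R, brick n3 — THE MODEL 13-J∘ IN `L²`, CLOSED FORM: no kernel hypotheses left

Route `FilamentSkeletonRss`, ∃-side clause 13 (`Clause13RNearStraightL` stmt-NavierStokesRegularity-23612; typing-agnostic); design
`filament-plan/DESIGN-28296-model-gluing-g16.md` + v2 addendum (tasks C6a+C6b).  `model_l2_estimate` (p709153) bounds `N(Y)` by `N(𝓛Y)` given a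
six-piece kernel system; here the kernel system is CONSTRUCTED (Schwartz mothers `…Clause13KernelMothers`, dilates `…Clause13KernelPackages`,
symbol facts `…Clause13KernelProfileFacts`) for every `0 < x_s ≤ 1/10` and `X ≥ 7/2`, with all 24 `L¹` moments bounded by ONE absolute constant
`C` (sum of the mothers' moments times `8π`) times the explicit scale factors `1, √q/x_s, 1/√q, √q, X/√q, √q/X`.  Result `model_l2_estimate_closed`:
`∃ C ≥ 0` such that for all model data `(q, G, R, Λ, Λ₂, b₁, b₂, L₁, L₂, β₀)`, all `0 < x_s ≤ 1/10`, `X ≥ 7/2`, `θ, η > 0`, every slip / multipliers /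
ball-supported `C¹_c` variation as in `model_l2_estimate`, and the closed-form abbreviations `α_s, δ_s` (now functions of `C` and the data only):
`6(δ₁+δ₂+2δ₃+δ₅+δ₆) ≤ ½ ⟹ N(Y) ≤ 12(α₁+α₂+2α₃+α₅+α₆)·N(𝓛Y)`.  The windows are `κ_S1 = (2/q)(x_s²/16)log(2/x_s)`, `κ_M = (2/q)/50`,
`σ₀ = 153/4000`.  What remains for clause 13 at MODEL level is only the clause-scaling corollary (choice of `x_s, X, θ, η` as functions of `Γ` and the
verification of the smallness condition for `R_b ≤ R_b0`, `Γ ≥ Γ₀`).  Inherits the certified-numerics axioms of the symbol windows (computational).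
Lane ns-filament-19175-p1 g17; `--supports stmt-NavierStokesRegularity-23612 --as helper`.
HONEST FRAMING: an `L²` a-priori estimate for an explicit 1-D model operator attached to a HYPOTHETICAL filament skeleton on the NEGATIVE side of a
MODEL route; nothing here bears on Navier–Stokes regularity or blow-up.
-/

noncomputable section

open MeasureTheory Real Complex Filter Set
open scoped ComplexConjugate Topology
open Summit.NavierStokesRegularity.NavierStokesRegularity.Theorems.AnalyticStripLiaSymbol (liaSym)

namespace Summit.NavierStokesRegularity.NavierStokesRegularity.Theorems.MatchedKernel
set_option linter.dupNamespace false

/-- Book-keeping: each of 23 nonnegative terms (and eight pairs of them) is bounded by their sum. [folklore] -/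
theorem sum23_bounds {t1 t2 t3 t4 t5 t6 t7 t8 t9 t10 t11 t12 t13 t14 t15 t16 t17 t18 t19 t20 t21 t22 t23 : ℝ}
    (h1 : 0 ≤ t1) (h2 : 0 ≤ t2) (h3 : 0 ≤ t3) (h4 : 0 ≤ t4) (h5 : 0 ≤ t5) (h6 : 0 ≤ t6) (h7 : 0 ≤ t7) (h8 : 0 ≤ t8) (h9 : 0 ≤ t9) (h10 : 0 ≤ t10) (h11 : 0 ≤ t11) (h12 : 0 ≤ t12) (h13 : 0 ≤ t13) (h14 : 0 ≤ t14) (h15 : 0 ≤ t15) (h16 : 0 ≤ t16) (h17 : 0 ≤ t17) (h18 : 0 ≤ t18) (h19 : 0 ≤ t19) (h20 : 0 ≤ t20) (h21 : 0 ≤ t21) (h22 : 0 ≤ t22) (h23 : 0 ≤ t23) :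
    (0 ≤ t1 + t2 + t3 + t4 + t5 + t6 + t7 + t8 + t9 + t10 + t11 + t12 + t13 + t14 + t15 + t16 + t17 + t18 + t19 + t20 + t21 + t22 + t23) ∧
    (t1 ≤ t1 + t2 + t3 + t4 + t5 + t6 + t7 + t8 + t9 + t10 + t11 + t12 + t13 + t14 + t15 + t16 + t17 + t18 + t19 + t20 + t21 + t22 + t23) ∧
    (t2 ≤ t1 + t2 + t3 + t4 + t5 + t6 + t7 + t8 + t9 + t10 + t11 + t12 + t13 + t14 + t15 + t16 + t17 + t18 + t19 + t20 + t21 + t22 + t23) ∧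
    (t3 ≤ t1 + t2 + t3 + t4 + t5 + t6 + t7 + t8 + t9 + t10 + t11 + t12 + t13 + t14 + t15 + t16 + t17 + t18 + t19 + t20 + t21 + t22 + t23) ∧
    (t4 ≤ t1 + t2 + t3 + t4 + t5 + t6 + t7 + t8 + t9 + t10 + t11 + t12 + t13 + t14 + t15 + t16 + t17 + t18 + t19 + t20 + t21 + t22 + t23) ∧
    (t5 ≤ t1 + t2 + t3 + t4 + t5 + t6 + t7 + t8 + t9 + t10 + t11 + t12 + t13 + t14 + t15 + t16 + t17 + t18 + t19 + t20 + t21 + t22 + t23) ∧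
    (t6 ≤ t1 + t2 + t3 + t4 + t5 + t6 + t7 + t8 + t9 + t10 + t11 + t12 + t13 + t14 + t15 + t16 + t17 + t18 + t19 + t20 + t21 + t22 + t23) ∧
    (t7 ≤ t1 + t2 + t3 + t4 + t5 + t6 + t7 + t8 + t9 + t10 + t11 + t12 + t13 + t14 + t15 + t16 + t17 + t18 + t19 + t20 + t21 + t22 + t23) ∧
    (t8 ≤ t1 + t2 + t3 + t4 + t5 + t6 + t7 + t8 + t9 + t10 + t11 + t12 + t13 + t14 + t15 + t16 + t17 + t18 + t19 + t20 + t21 + t22 + t23) ∧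
    (t9 ≤ t1 + t2 + t3 + t4 + t5 + t6 + t7 + t8 + t9 + t10 + t11 + t12 + t13 + t14 + t15 + t16 + t17 + t18 + t19 + t20 + t21 + t22 + t23) ∧
    (t10 ≤ t1 + t2 + t3 + t4 + t5 + t6 + t7 + t8 + t9 + t10 + t11 + t12 + t13 + t14 + t15 + t16 + t17 + t18 + t19 + t20 + t21 + t22 + t23) ∧
    (t11 ≤ t1 + t2 + t3 + t4 + t5 + t6 + t7 + t8 + t9 + t10 + t11 + t12 + t13 + t14 + t15 + t16 + t17 + t18 + t19 + t20 + t21 + t22 + t23) ∧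
    (t12 ≤ t1 + t2 + t3 + t4 + t5 + t6 + t7 + t8 + t9 + t10 + t11 + t12 + t13 + t14 + t15 + t16 + t17 + t18 + t19 + t20 + t21 + t22 + t23) ∧
    (t13 ≤ t1 + t2 + t3 + t4 + t5 + t6 + t7 + t8 + t9 + t10 + t11 + t12 + t13 + t14 + t15 + t16 + t17 + t18 + t19 + t20 + t21 + t22 + t23) ∧
    (t14 ≤ t1 + t2 + t3 + t4 + t5 + t6 + t7 + t8 + t9 + t10 + t11 + t12 + t13 + t14 + t15 + t16 + t17 + t18 + t19 + t20 + t21 + t22 + t23) ∧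
    (t15 ≤ t1 + t2 + t3 + t4 + t5 + t6 + t7 + t8 + t9 + t10 + t11 + t12 + t13 + t14 + t15 + t16 + t17 + t18 + t19 + t20 + t21 + t22 + t23) ∧
    (t16 ≤ t1 + t2 + t3 + t4 + t5 + t6 + t7 + t8 + t9 + t10 + t11 + t12 + t13 + t14 + t15 + t16 + t17 + t18 + t19 + t20 + t21 + t22 + t23) ∧
    (t17 ≤ t1 + t2 + t3 + t4 + t5 + t6 + t7 + t8 + t9 + t10 + t11 + t12 + t13 + t14 + t15 + t16 + t17 + t18 + t19 + t20 + t21 + t22 + t23) ∧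
    (t18 ≤ t1 + t2 + t3 + t4 + t5 + t6 + t7 + t8 + t9 + t10 + t11 + t12 + t13 + t14 + t15 + t16 + t17 + t18 + t19 + t20 + t21 + t22 + t23) ∧
    (t19 ≤ t1 + t2 + t3 + t4 + t5 + t6 + t7 + t8 + t9 + t10 + t11 + t12 + t13 + t14 + t15 + t16 + t17 + t18 + t19 + t20 + t21 + t22 + t23) ∧
    (t20 ≤ t1 + t2 + t3 + t4 + t5 + t6 + t7 + t8 + t9 + t10 + t11 + t12 + t13 + t14 + t15 + t16 + t17 + t18 + t19 + t20 + t21 + t22 + t23) ∧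
    (t21 ≤ t1 + t2 + t3 + t4 + t5 + t6 + t7 + t8 + t9 + t10 + t11 + t12 + t13 + t14 + t15 + t16 + t17 + t18 + t19 + t20 + t21 + t22 + t23) ∧
    (t22 ≤ t1 + t2 + t3 + t4 + t5 + t6 + t7 + t8 + t9 + t10 + t11 + t12 + t13 + t14 + t15 + t16 + t17 + t18 + t19 + t20 + t21 + t22 + t23) ∧
    (t23 ≤ t1 + t2 + t3 + t4 + t5 + t6 + t7 + t8 + t9 + t10 + t11 + t12 + t13 + t14 + t15 + t16 + t17 + t18 + t19 + t20 + t21 + t22 + t23) ∧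
    (t10 + t1 ≤ t1 + t2 + t3 + t4 + t5 + t6 + t7 + t8 + t9 + t10 + t11 + t12 + t13 + t14 + t15 + t16 + t17 + t18 + t19 + t20 + t21 + t22 + t23) ∧
    (t11 + t2 ≤ t1 + t2 + t3 + t4 + t5 + t6 + t7 + t8 + t9 + t10 + t11 + t12 + t13 + t14 + t15 + t16 + t17 + t18 + t19 + t20 + t21 + t22 + t23) ∧
    (t12 + t3 ≤ t1 + t2 + t3 + t4 + t5 + t6 + t7 + t8 + t9 + t10 + t11 + t12 + t13 + t14 + t15 + t16 + t17 + t18 + t19 + t20 + t21 + t22 + t23) ∧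
    (t13 + t4 ≤ t1 + t2 + t3 + t4 + t5 + t6 + t7 + t8 + t9 + t10 + t11 + t12 + t13 + t14 + t15 + t16 + t17 + t18 + t19 + t20 + t21 + t22 + t23) ∧
    (t1 + t14 ≤ t1 + t2 + t3 + t4 + t5 + t6 + t7 + t8 + t9 + t10 + t11 + t12 + t13 + t14 + t15 + t16 + t17 + t18 + t19 + t20 + t21 + t22 + t23) ∧
    (t2 + t15 ≤ t1 + t2 + t3 + t4 + t5 + t6 + t7 + t8 + t9 + t10 + t11 + t12 + t13 + t14 + t15 + t16 + t17 + t18 + t19 + t20 + t21 + t22 + t23) ∧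
    (t3 + t16 ≤ t1 + t2 + t3 + t4 + t5 + t6 + t7 + t8 + t9 + t10 + t11 + t12 + t13 + t14 + t15 + t16 + t17 + t18 + t19 + t20 + t21 + t22 + t23) ∧
    (t4 + t17 ≤ t1 + t2 + t3 + t4 + t5 + t6 + t7 + t8 + t9 + t10 + t11 + t12 + t13 + t14 + t15 + t16 + t17 + t18 + t19 + t20 + t21 + t22 + t23) := by
  refine ⟨?_, ?_, ?_, ?_, ?_, ?_, ?_, ?_, ?_, ?_, ?_, ?_, ?_, ?_, ?_, ?_, ?_, ?_, ?_, ?_, ?_, ?_, ?_, ?_, ?_, ?_, ?_, ?_, ?_, ?_, ?_, ?_⟩ <;>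
  linarith only [h1, h2, h3, h4, h5, h6, h7, h8, h9, h10, h11, h12, h13, h14, h15, h16, h17, h18, h19, h20, h21, h22, h23]

/-- Book-keeping: the three dilation factors `μ₁ = 4π√q/x_s`, `μ₂ = 2π√q`, `μ₄ = 2π√q/X` against the absolute constant `8πM`. [folklore] -/
theorem scale_shapes {M q xs X : ℝ} (hM0 : 0 ≤ M) (hq : 0 < q) (hxs : 0 < xs) (hxs' : xs ≤ 1 / 10) (hX : 7 / 2 ≤ X) :
    (4 * π * √q / xs) * M ≤ 8 * π * M * √q / xs ∧ (2 * π * √q) * M ≤ 8 * π * M * √q ∧ (2 * π * √q / X) * M ≤ 8 * π * M * √q / X ∧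
    (4 * π * √q / xs)⁻¹ * M ≤ 8 * π * M / √q ∧ (2 * π * √q)⁻¹ * M ≤ 8 * π * M / √q ∧ (2 * π * √q / X)⁻¹ * M ≤ 8 * π * M * X / √q ∧
    M ≤ 8 * π * M ∧ 2 * π * √q ≤ 4 * π * √q / xs ∧ 2 * π * √q / X ≤ 2 * π * √q ∧
    0 < 4 * π * √q / xs ∧ 0 < 2 * π * √q ∧ 0 < 2 * π * √q / X := by
  have hπ3 := Real.pi_gt_three
  have hsq : 0 < √q := Real.sqrt_pos.2 hq
  have hps : 0 < π * √q := mul_pos Real.pi_pos hsq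
  have hX0 : 0 < X := by linarith only [hX]
  have hX1 : 1 ≤ X := by linarith only [hX]
  have h2π : (0:ℝ) < 2 * π := by linarith only [hπ3]
  have fM : M ≤ 8 * π * M := by
    have : 0 ≤ (8 * π - 1) * M := mul_nonneg (by linarith only [hπ3]) hM0
    linarith only [this]
  have hq8 : M / √q ≤ 8 * π * M / √q := by rw [div_le_div_iff_of_pos_right hsq]; exact fM
  refine ⟨?_, ?_, ?_, ?_, ?_, ?_, fM, ?_, ?_, div_pos (by linarith only [hps]) hxs, by linarith only [hps], div_pos (by linarith only [hps]) hX0⟩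
  · have h0 : 0 ≤ π * √q * M / xs := div_nonneg (mul_nonneg hps.le hM0) hxs.le
    have e1 : 4 * π * √q / xs * M = 4 * (π * √q * M / xs) := by ring
    have e2 : 8 * π * M * √q / xs = 8 * (π * √q * M / xs) := by ring
    rw [e1, e2]; linarith only [h0]
  · have h0 : 0 ≤ π * √q * M := mul_nonneg hps.le hM0
    have e1 : 2 * π * √q * M = 2 * (π * √q * M) := by ring
    have e2 : 8 * π * M * √q = 8 * (π * √q * M) := by ring
    rw [e1, e2]; linarith only [h0]
  · have h0 : 0 ≤ π * √q * M / X := div_nonneg (mul_nonneg hps.le hM0) hX0.le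
    have e1 : 2 * π * √q / X * M = 2 * (π * √q * M / X) := by ring
    have e2 : 8 * π * M * √q / X = 8 * (π * √q * M / X) := by ring
    rw [e1, e2]; linarith only [h0]
  · have e : (4 * π * √q / xs)⁻¹ * M = (xs / (4 * π)) * (M / √q) := by rw [inv_div]; ring
    rw [e]
    have hc : xs / (4 * π) ≤ 1 := by rw [div_le_one (by linarith only [hπ3])]; linarith only [hπ3, hxs']
    have h0 : 0 ≤ M / √q := div_nonneg hM0 hsq.le
    calc xs / (4 * π) * (M / √q) ≤ 1 * (M / √q) := mul_le_mul_of_nonneg_right hc h0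
      _ ≤ 8 * π * M / √q := by rw [one_mul]; exact hq8
  · have e : (2 * π * √q)⁻¹ * M = (1 / (2 * π)) * (M / √q) := by ring
    rw [e]
    have hc : 1 / (2 * π) ≤ 1 := by rw [div_le_one h2π]; linarith only [hπ3]
    have h0 : 0 ≤ M / √q := div_nonneg hM0 hsq.le
    calc 1 / (2 * π) * (M / √q) ≤ 1 * (M / √q) := mul_le_mul_of_nonneg_right hc h0
      _ ≤ 8 * π * M / √q := by rw [one_mul]; exact hq8
  · have e : (2 * π * √q / X)⁻¹ * M = (1 / (2 * π)) * (M * X / √q) := by rw [inv_div]; ring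
    rw [e]
    have hc : 1 / (2 * π) ≤ 1 := by rw [div_le_one h2π]; linarith only [hπ3]
    have h0 : 0 ≤ M * X / √q := div_nonneg (mul_nonneg hM0 hX0.le) hsq.le
    have hq8' : M * X / √q ≤ 8 * π * M * X / √q := by
      rw [div_le_div_iff_of_pos_right hsq]
      have : 0 ≤ (8 * π * M - M) * X := mul_nonneg (by linarith only [fM]) hX0.le
      linarith only [this]
    calc 1 / (2 * π) * (M * X / √q) ≤ 1 * (M * X / √q) := mul_le_mul_of_nonneg_right hc h0
      _ ≤ 8 * π * M * X / √q := by rw [one_mul]; exact hq8'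
  · rw [le_div_iff₀ hxs]
    have : 0 ≤ π * √q * (4 - 2 * xs) := mul_nonneg hps.le (by linarith only [hxs'])
    linarith only [this]
  · rw [div_le_iff₀ hX0]
    have : 0 ≤ π * √q * (2 * X - 2) := mul_nonneg hps.le (by linarith only [hX1])
    linarith only [this]

/-- **THE MODEL 13-J∘ IN `L²`, CLOSED FORM.**  See the module docstring. [folklore] -/
theorem model_l2_estimate_closed : ∃ C : ℝ, 0 ≤ C ∧
    ∀ {q G R Λ Λ₂ b₁ b₂ L₁ L₂ β₀ c xs X θ η : ℝ},
    0 < q → 0 < G → 0 ≤ R → 0 < xs → xs ≤ 1 / 10 → 7 / 2 ≤ X → 0 < θ → 0 < η → 0 < β₀ →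
    ∀ {Y : ℝ → ℂ}, ContDiff ℝ 1 Y → HasCompactSupport Y → (∀ x, x ∉ Set.Icc (c - R) (c + R) → Y x = 0) →
    ∀ {w : ℝ → ℝ}, Differentiable ℝ w → Differentiable ℝ (deriv w) → (∀ t, |deriv w t| ≤ Λ) → (∀ t, |deriv (deriv w) t| ≤ Λ₂) → w c = 0 →
    ∀ {β₁ β₂ β₂' : ℝ → ℂ}, Continuous β₁ → (∀ τ, ‖β₁ τ‖ ≤ b₁) → (∀ x y, ‖β₁ y - β₁ x‖ ≤ L₁ * |y - x|) →
      (∀ τ, HasDerivAt β₂ (β₂' τ) τ) → Continuous β₂' → (∀ τ, ‖β₂ τ‖ ≤ b₂) → (∀ τ, ‖β₂' τ‖ ≤ L₂) →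
      (∀ τ, β₀ ≤ 1 / 2 * deriv w τ + (β₁ τ).re) →
    ∀ {gS0 ε ℓ cH CF RW αT δT α₁ α₂ α₃ α₅ α₆ δ₁ δ₂ δ₃ δ₅ δ₆ : ℝ}
    (egS0 : gS0 = G * (1 / 2 * Real.log (1 / xs))) (eε : ε = b₂ * q / (4 * G)) (hε1 : ε < 1) (eℓ : ℓ = L₂ * q / (4 * G))
    (ecH : cH = (1 + ε) * G * (2 / q * (5 * Real.exp (-(X / 2)))) + 2 * b₁ * ε + 2 * (2 * G / q) * ε ^ 2)
    (eCF : CF = Λ₂ * ((C * √q / X) + (C * √q / X)) + (L₁ + L₂) * (C * √q / X)) (eRW : RW = R + Real.sqrt 2 * (C * R + (C * √q / X))) (eαT : αT = C ^ 2 / (G * (2 / q * (1 / 50))))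
    (eδT : δT = ((Λ * (C + C) + (L₁ + L₂) * (C * √q / X) + (b₁ + b₂) * C + Real.sqrt 2 * Λ * C) + Real.sqrt 2 * Λ * (C * X / √q) * R) * C / (G * (2 / q * (1 / 50))))
    (eα₁ : α₁ = q / θ ^ 2 * (2 / gS0) * C ^ 2)
    (eδ₁ : δ₁ = θ / (Real.pi * √q) * C ^ 2 * (2 * R)
      + q / θ ^ 2 * (2 / gS0 * ((Λ * (C + C) + (L₁ + L₂) * (C * √q / xs)) * C + (b₁ + b₂) * C ^ 2) + Λ ^ 2 / gS0 ^ 2 * (2 * (C * R + (C * √q / xs)) ^ 2)))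
    (eα₂ : α₂ = C ^ 2 / (G * (2 / q * (xs ^ 2 / 16 * Real.log (2 / xs)))))
    (eδ₂ : δ₂ = ((Λ * (C + C) + (L₁ + L₂) * (C * √q / xs) + (b₁ + b₂) * C + Real.sqrt 2 * Λ * C) + Real.sqrt 2 * Λ * (C / √q) * R) * C / (G * (2 / q * (xs ^ 2 / 16 * Real.log (2 / xs)))))
    (eα₃ : α₃ = √q * (Real.sqrt 2 * ((C + C) * R + ((C * √q) + (C * √q)))) * (C + C) / (G * (153 / 4000)))
    (eδ₃ : δ₃ = √q * (Real.sqrt 2 * ((C + C) * R + ((C * √q) + (C * √q))))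
      * (Λ * ((C + C) + (C + C)) + (L₁ + L₂) * ((C * √q) + (C * √q)) + (Λ + b₁ + 3 * b₂) * (C + C)) / (G * (153 / 4000)))
    (eα₅ : α₅ = C ^ 2 / (G * (2 / q * (1 / 50))))
    (eδ₅ : δ₅ = ((Λ * (C + C) + (L₁ + L₂) * (C * √q) + (b₁ + b₂) * C + Real.sqrt 2 * Λ * C) + Real.sqrt 2 * Λ * (C * X / √q) * R) * C / (G * (2 / q * (1 / 50))))
    (eα₆ : α₆ = (1 + ε) ^ 2 * (1 + C) * ((1 + C) + Λ * αT / (2 * η)) / (β₀ * (1 - ε) ^ 2))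
    (eδ₆ : δ₆ = ((1 + ε) ^ 2 * (1 + C) * Λ * (δT / (2 * η) + η / 2) + (1 + ε) * (1 + C) * ((1 + ε) * CF + cH * (1 + C) + ℓ * Λ * RW))
      / (β₀ * (1 - ε) ^ 2))
    (hδ : 6 * (δ₁ + δ₂ + δ₃ + δ₃ + δ₅ + δ₆) ≤ 1 / 2),
    (∫ y : ℝ, ‖Y y‖ ^ 2) ^ (1 / 2 : ℝ)
      ≤ 12 * (α₁ + α₂ + α₃ + α₃ + α₅ + α₆) * (∫ y : ℝ, ‖I * (G : ℂ) * ((2 / q : ℂ) * Y y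
              - ∫ σ : ℝ, ((((2 * q - (y - σ) ^ 2) * (((y - σ) ^ 2 + q) ^ (5 / 2 : ℝ))⁻¹ : ℝ)) : ℂ) * Y σ)
            - ((w y : ℝ) : ℂ) * deriv Y y + β₁ y * Y y + β₂ y * conj (Y y)‖ ^ 2) ^ (1 / 2 : ℝ) := by
  /- §1 the mothers and the absolute constant -/
  obtain ⟨r₁, r₁', r₁'', B₁₀, B₁₁, m1d, m1d', m1c', m1c'', m1i, m1i1, m1di, m1di1, m1di2, m1ddi1, m1ddi2, m1B0, m1B1, m1Φ⟩ :=
    reMother_exists (α := (1 : ℝ)) (β := 2) zero_le_one one_lt_two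
  obtain ⟨r₂, r₂', r₂'', r₃, r₃', r₃'', α, α', β, β', B₂₀, B₂₁, B₃₀, B₃₁, Bα, Bβ,
    ⟨m2d, m2d', m2c', m2c'', m2i, m2i1, m2di, m2di1, m2di2, m2ddi1, m2ddi2, m2B0, m2B1, m2Φ⟩,
    ⟨m3d, m3d', m3c', m3c'', m3i, m3i1, m3di, m3di1, m3di2, m3ddi1, m3ddi2, m3B0, m3B1, m3Φ⟩,
    ⟨bαd, bαc', bαi, bαdi, bαi1, bαdi1, bαB, bαev, bβd, bβc', bβi, bβdi, bβi1, bβdi1, bβB, bβodd, bΦ⟩, hpart⟩ := bandMothers_exist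
  -- the 23 mother moments
  have n01 : 0 ≤ ∫ u, |r₁ u| := integral_nonneg fun u => abs_nonneg _
  have n02 : 0 ≤ ∫ u, |u| * |r₁ u| := integral_nonneg fun u => mul_nonneg (abs_nonneg _) (abs_nonneg _)
  have n03 : 0 ≤ ∫ u, |r₁' u| := integral_nonneg fun u => abs_nonneg _
  have n04 : 0 ≤ ∫ u, |u| * |r₁' u| := integral_nonneg fun u => mul_nonneg (abs_nonneg _) (abs_nonneg _)
  have n05 : 0 ≤ ∫ u, u ^ 2 * |r₁' u| := integral_nonneg fun u => mul_nonneg (sq_nonneg _) (abs_nonneg _)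
  have n06 : 0 ≤ ∫ u, |u * r₁' u + r₁ u| := integral_nonneg fun u => abs_nonneg _
  have n07 : 0 ≤ ∫ u, |u| * |u * r₁' u + r₁ u| := integral_nonneg fun u => mul_nonneg (abs_nonneg _) (abs_nonneg _)
  have n08 : 0 ≤ ∫ u, |2 * r₁' u + u * r₁'' u| := integral_nonneg fun u => abs_nonneg _
  have n09 : 0 ≤ ∫ u, |u| * |2 * r₁' u + u * r₁'' u| := integral_nonneg fun u => mul_nonneg (abs_nonneg _) (abs_nonneg _)
  have n10 : 0 ≤ ∫ u, |r₂ u| := integral_nonneg fun u => abs_nonneg _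
  have n11 : 0 ≤ ∫ u, |u| * |r₂ u| := integral_nonneg fun u => mul_nonneg (abs_nonneg _) (abs_nonneg _)
  have n12 : 0 ≤ ∫ u, |r₂' u| := integral_nonneg fun u => abs_nonneg _
  have n13 : 0 ≤ ∫ u, |u| * |r₂' u| := integral_nonneg fun u => mul_nonneg (abs_nonneg _) (abs_nonneg _)
  have n14 : 0 ≤ ∫ u, |r₃ u| := integral_nonneg fun u => abs_nonneg _
  have n15 : 0 ≤ ∫ u, |u| * |r₃ u| := integral_nonneg fun u => mul_nonneg (abs_nonneg _) (abs_nonneg _)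
  have n16 : 0 ≤ ∫ u, |r₃' u| := integral_nonneg fun u => abs_nonneg _
  have n17 : 0 ≤ ∫ u, |u| * |r₃' u| := integral_nonneg fun u => mul_nonneg (abs_nonneg _) (abs_nonneg _)
  have n18 : 0 ≤ ∫ u, |α u| := integral_nonneg fun u => abs_nonneg _
  have n19 : 0 ≤ ∫ u, |u| * |α u| := integral_nonneg fun u => mul_nonneg (abs_nonneg _) (abs_nonneg _)
  have n20 : 0 ≤ ∫ u, |u| * |α' u| := integral_nonneg fun u => mul_nonneg (abs_nonneg _) (abs_nonneg _)
  have n21 : 0 ≤ ∫ u, |β u| := integral_nonneg fun u => abs_nonneg _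
  have n22 : 0 ≤ ∫ u, |u| * |β u| := integral_nonneg fun u => mul_nonneg (abs_nonneg _) (abs_nonneg _)
  have n23 : 0 ≤ ∫ u, |u| * |β' u| := integral_nonneg fun u => mul_nonneg (abs_nonneg _) (abs_nonneg _)
  obtain ⟨hM0, l01, l02, l03, l04, l05, l06, l07, l08, l09, s10, s11, s12, s13, s14, s15, s16, s17, l18, l19, l20, l21, l22, l23,
    l10, l11, l12, l13, l14, l15, l16, l17⟩ :=
    sum23_bounds n01 n02 n03 n04 n05 n06 n07 n08 n09 n10 n11 n12 n13 n14 n15 n16 n17 n18 n19 n20 n21 n22 n23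
  set M : ℝ := (∫ u, |r₁ u|) + (∫ u, |u| * |r₁ u|) + (∫ u, |r₁' u|) + (∫ u, |u| * |r₁' u|) + (∫ u, u ^ 2 * |r₁' u|)
      + (∫ u, |u * r₁' u + r₁ u|) + (∫ u, |u| * |u * r₁' u + r₁ u|) + (∫ u, |2 * r₁' u + u * r₁'' u|) + (∫ u, |u| * |2 * r₁' u + u * r₁'' u|)
      + (∫ u, |r₂ u|) + (∫ u, |u| * |r₂ u|) + (∫ u, |r₂' u|) + (∫ u, |u| * |r₂' u|)
      + (∫ u, |r₃ u|) + (∫ u, |u| * |r₃ u|) + (∫ u, |r₃' u|) + (∫ u, |u| * |r₃' u|)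
      + (∫ u, |α u|) + (∫ u, |u| * |α u|) + (∫ u, |u| * |α' u|) + (∫ u, |β u|) + (∫ u, |u| * |β u|) + (∫ u, |u| * |β' u|) with hM
  have hπ3 := Real.pi_gt_three
  have hC0 : 0 ≤ 8 * π * M := mul_nonneg (mul_nonneg (by norm_num) Real.pi_pos.le) hM0
  refine ⟨8 * π * M, hC0, ?_⟩
  intro q G R Λ Λ₂ b₁ b₂ L₁ L₂ β₀ c xs X θ η hq hG hR hxs hxs' hX hθ hη hβ₀ Y hY hYs hYR w hw hw2 hΛ hΛ₂ hwc β₁ β₂ β₂' hβ₁c hb₁ hL₁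
    hβ₂ hβ₂'c hb₂ hL₂ hgrowth gS0 ε ℓ cH CF RW αT δT α₁ α₂ α₃ α₅ α₆ δ₁ δ₂ δ₃ δ₅ δ₆ egS0 eε hε1 eℓ ecH eCF eRW eαT eδT eα₁ eδ₁ eα₂ eδ₂ eα₃ eδ₃
    eα₅ eδ₅ eα₆ eδ₆ hδ
  /- §2 scales and kernels -/
  have hsq : 0 < √q := Real.sqrt_pos.2 hq
  have hX0 : 0 < X := by linarith only [hX]
  obtain ⟨μ₁, hμ₁⟩ : ∃ μ : ℝ, μ = 4 * π * √q / xs := ⟨_, rfl⟩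
  obtain ⟨μ₂, hμ₂⟩ : ∃ μ : ℝ, μ = 2 * π * √q := ⟨_, rfl⟩
  obtain ⟨μ₄, hμ₄⟩ : ∃ μ : ℝ, μ = 2 * π * √q / X := ⟨_, rfl⟩
  obtain ⟨f1, f2, f4, f1i, f2i, f4i, fM, hμ21, hμ42, hμ₁p, hμ₂p, hμ₄p⟩ := scale_shapes hM0 hq hxs hxs' hX
  rw [← hμ₁] at f1 f1i hμ21 hμ₁p
  rw [← hμ₄] at f4 f4i hμ42 hμ₄p
  rw [← hμ₂] at f2 f2i hμ21 hμ42 hμ₂p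
  obtain ⟨kS0, ekS0⟩ : ∃ k : ℝ → ℝ, ∀ t, k t = μ₁⁻¹ * r₁ (t / μ₁) := ⟨_, fun t => rfl⟩
  obtain ⟨kS0', ekS0'⟩ : ∃ k : ℝ → ℝ, ∀ t, k t = μ₁⁻¹ * (μ₁⁻¹ * r₁' (t / μ₁)) := ⟨_, fun t => rfl⟩
  obtain ⟨kS0'', ekS0''⟩ : ∃ k : ℝ → ℝ, ∀ t, k t = μ₁⁻¹ * (μ₁⁻¹ * (μ₁⁻¹ * r₁'' (t / μ₁))) := ⟨_, fun t => rfl⟩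
  obtain ⟨kU2, ekU2⟩ : ∃ k : ℝ → ℝ, ∀ t, k t = μ₂⁻¹ * r₂ (t / μ₂) := ⟨_, fun t => rfl⟩
  obtain ⟨kU2', ekU2'⟩ : ∃ k : ℝ → ℝ, ∀ t, k t = μ₂⁻¹ * (μ₂⁻¹ * r₂' (t / μ₂)) := ⟨_, fun t => rfl⟩
  obtain ⟨kU2'', ekU2''⟩ : ∃ k : ℝ → ℝ, ∀ t, k t = μ₂⁻¹ * (μ₂⁻¹ * (μ₂⁻¹ * r₂'' (t / μ₂))) := ⟨_, fun t => rfl⟩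
  obtain ⟨kU3, ekU3⟩ : ∃ k : ℝ → ℝ, ∀ t, k t = μ₂⁻¹ * r₃ (t / μ₂) := ⟨_, fun t => rfl⟩
  obtain ⟨kU3', ekU3'⟩ : ∃ k : ℝ → ℝ, ∀ t, k t = μ₂⁻¹ * (μ₂⁻¹ * r₃' (t / μ₂)) := ⟨_, fun t => rfl⟩
  obtain ⟨kU3'', ekU3''⟩ : ∃ k : ℝ → ℝ, ∀ t, k t = μ₂⁻¹ * (μ₂⁻¹ * (μ₂⁻¹ * r₃'' (t / μ₂))) := ⟨_, fun t => rfl⟩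
  obtain ⟨kN, ekN⟩ : ∃ k : ℝ → ℝ, ∀ t, k t = μ₄⁻¹ * r₁ (t / μ₄) := ⟨_, fun t => rfl⟩
  obtain ⟨kN', ekN'⟩ : ∃ k : ℝ → ℝ, ∀ t, k t = μ₄⁻¹ * (μ₄⁻¹ * r₁' (t / μ₄)) := ⟨_, fun t => rfl⟩
  obtain ⟨kN'', ekN''⟩ : ∃ k : ℝ → ℝ, ∀ t, k t = μ₄⁻¹ * (μ₄⁻¹ * (μ₄⁻¹ * r₁'' (t / μ₄))) := ⟨_, fun t => rfl⟩
  obtain ⟨ka, eka⟩ : ∃ k : ℝ → ℝ, ∀ t, k t = μ₂⁻¹ * α (t / μ₂) := ⟨_, fun t => rfl⟩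
  obtain ⟨ka', eka'⟩ : ∃ k : ℝ → ℝ, ∀ t, k t = μ₂⁻¹ * (μ₂⁻¹ * α' (t / μ₂)) := ⟨_, fun t => rfl⟩
  obtain ⟨kb, ekb⟩ : ∃ k : ℝ → ℝ, ∀ t, k t = μ₂⁻¹ * β (t / μ₂) := ⟨_, fun t => rfl⟩
  obtain ⟨kb', ekb'⟩ : ∃ k : ℝ → ℝ, ∀ t, k t = μ₂⁻¹ * (μ₂⁻¹ * β' (t / μ₂)) := ⟨_, fun t => rfl⟩
  /- §3 packages -/
  obtain ⟨S0d, -, S0c', -, S0i, S0di, S0i1, S0di1, -, -, -, S0B, -, S0Φ, S0m0, S0m1, S0md, S0md1, -, -, -, -, -⟩ :=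
    scaled_package m1d m1d' m1c' m1c'' m1i m1i1 m1di m1di1 m1di2 m1ddi1 m1ddi2 m1B0 m1B1 m1Φ hμ₁p ekS0 ekS0' ekS0''
  obtain ⟨U2d, -, U2c', -, U2i, U2di, U2i1, U2di1, -, -, -, U2B, -, U2Φ, U2m0, U2m1, U2md, U2md1, -, -, -, -, -⟩ :=
    scaled_package m2d m2d' m2c' m2c'' m2i m2i1 m2di m2di1 m2di2 m2ddi1 m2ddi2 m2B0 m2B1 m2Φ hμ₂p ekU2 ekU2' ekU2''
  obtain ⟨U3d, -, U3c', -, U3i, U3di, U3i1, U3di1, -, -, -, U3B, -, U3Φ, U3m0, U3m1, U3md, U3md1, -, -, -, -, -⟩ :=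
    scaled_package m3d m3d' m3c' m3c'' m3i m3i1 m3di m3di1 m3di2 m3ddi1 m3ddi2 m3B0 m3B1 m3Φ hμ₂p ekU3 ekU3' ekU3''
  obtain ⟨Nd, Nd', Nc', Nc'', Ni, Ndi, Ni1, Ndi1, Ndi2, Nddi1, Nddi2, NB, NTB, NΦ, Nm0, Nm1, Nmd, Nmd1, Nmd2, NmT, NmT1, NmTd, NmTd1⟩ :=
    scaled_package m1d m1d' m1c' m1c'' m1i m1i1 m1di m1di1 m1di2 m1ddi1 m1ddi2 m1B0 m1B1 m1Φ hμ₄p ekN ekN' ekN''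
  obtain ⟨ad, ac', ai, adi, ai1, adi1, aB, aev, bd, bc', bi, bdi, bi1, bdi1, bB, bodd, abΦ, am0, am1, amd1, bm0, bm1, bmd1⟩ :=
    scaledBand_package bαd bαc' bαi bαdi bαi1 bαdi1 bαB bαev bβd bβc' bβi bβdi bβi1 bβdi1 bβB bβodd bΦ hμ₂p eka eka' ekb ekb'
  obtain ⟨kS1, ekS1⟩ : ∃ k : ℝ → ℝ, ∀ t, k t = kU2 t - kS0 t := ⟨_, fun t => rfl⟩
  obtain ⟨kS1', ekS1'⟩ : ∃ k : ℝ → ℝ, ∀ t, k t = kU2' t - kS0' t := ⟨_, fun t => rfl⟩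
  obtain ⟨kM, ekM⟩ : ∃ k : ℝ → ℝ, ∀ t, k t = kN t - kU3 t := ⟨_, fun t => rfl⟩
  obtain ⟨kM', ekM'⟩ : ∃ k : ℝ → ℝ, ∀ t, k t = kN' t - kU3' t := ⟨_, fun t => rfl⟩
  obtain ⟨S1d, S1c', S1i, S1di, S1i1, S1di1, S1B, S1Φ, S1m0, S1m1, S1md, S1md1⟩ :=
    diff_package U2d S0d U2c' S0c' U2i S0i U2di S0di U2i1 S0i1 U2di1 S0di1 U2B S0B U2Φ S0Φ ekS1 ekS1'
  obtain ⟨Md, Mc', Mi, Mdi, Mi1, Mdi1, MB, MΦ, Mm0, Mm1, Mmd, Mmd1⟩ :=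
    diff_package Nd U3d Nc' U3c' Ni U3i Ndi U3di Ni1 U3i1 Ndi1 U3di1 NB U3B NΦ U3Φ ekM ekM'
  /- §4 symbol / support facts -/
  have h2π : (0:ℝ) < 2 * π := by linarith only [hπ3]
  have hy₁ : ∀ z : ℝ, |(-(μ₁ * z) / (2 * π))| = 2 * √q / xs * |z| := fun z => by
    rw [abs_div, abs_neg, abs_mul, abs_of_pos hμ₁p, abs_of_pos h2π, hμ₁, div_eq_iff h2π.ne']
    ring
  have hy₁' : ∀ z : ℝ, |(-(μ₁ * z) / (2 * π))| = 2 / xs * |z * √q| := fun z => by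
    rw [hy₁ z, abs_mul, abs_of_nonneg hsq.le]; ring
  have hy₂ : ∀ z : ℝ, |(-(μ₂ * z) / (2 * π))| = |z * √q| := fun z => by
    rw [abs_div, abs_neg, abs_mul, abs_of_pos hμ₂p, abs_of_pos h2π, hμ₂, abs_mul, abs_of_nonneg hsq.le, div_eq_iff h2π.ne']
    ring
  have hy₂' : ∀ z : ℝ, μ₂ * z / (2 * π) = z * √q := fun z => by rw [hμ₂, div_eq_iff h2π.ne']; ring
  have hy₄ : ∀ z : ℝ, |(-(μ₄ * z) / (2 * π))| = |z * √q| / X := fun z => by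
    rw [abs_div, abs_neg, abs_mul, abs_of_pos hμ₄p, abs_of_pos h2π, hμ₄, abs_mul, abs_of_nonneg hsq.le, div_eq_iff h2π.ne']
    ring
  have hS0supp := S0supp_of_profile hxs S0Φ hy₁
  have hS1sym := S1sym_of_profile hq hxs hxs' S1Φ hy₂ hy₁'
  have hband := band_of_profile abΦ hy₂'
  have hMsym := MIDsym_of_profile hq hX MΦ hy₄ hy₂
  have hNfar := Nfar_of_profile hX0 NΦ hy₄
  have hs : |(-μ₄ / (2 * π))| = √q / X := by
    rw [abs_div, abs_neg, abs_of_pos hμ₄p, abs_of_pos h2π, hμ₄, div_eq_iff h2π.ne']; ring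
  have NΦ' : ∀ z : ℝ, ∫ t : ℝ, ((kN t : ℝ) : ℂ) * cexp (I * z * t)
      = (((smoothTransition ((2 - -μ₄ / (2 * π) * z) / (2 - 1)) + smoothTransition ((2 + -μ₄ / (2 * π) * z) / (2 - 1)) - 1 : ℝ)) : ℂ) := by
    intro z; rw [NΦ z, show -(μ₄ * z) / (2 * π) = -μ₄ / (2 * π) * z by ring]
  have hTsym := Tsym_of_profile Nd Ni Ni1 Ndi1 hq hX hs NΦ'
  have hsum' : ∀ t, kN t = kS0 t + kS1 t + 2 * ka t + kM t := by
    intro t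
    rw [ekS1, ekM, ekU3, ekU2, eka, hpart]
    ring
  /- §5 moment bounds -/
  have bS0K : ∫ t, |kS0 t| ≤ 8 * π * M := by rw [S0m0]; linarith only [l01, fM]
  have bS0K1 : ∫ t, |t| * |kS0 t| ≤ 8 * π * M * √q / xs := by
    rw [S0m1]; exact (mul_le_mul_of_nonneg_left l02 hμ₁p.le).trans f1
  have bS0Kd1 : ∫ t, |t| * |kS0' t| ≤ 8 * π * M := by rw [S0md1]; linarith only [l04, fM]
  have bS1K : ∫ t, |kS1 t| ≤ 8 * π * M := by rw [U2m0, S0m0] at S1m0; linarith only [S1m0, l10, fM]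
  have bS1K1 : ∫ t, |t| * |kS1 t| ≤ 8 * π * M * √q / xs := by
    rw [U2m1, S0m1] at S1m1
    have h1 : μ₂ * (∫ u, |u| * |r₂ u|) ≤ μ₁ * (∫ u, |u| * |r₂ u|) := mul_le_mul_of_nonneg_right hμ21 n11
    have h2 : μ₁ * (∫ u, |u| * |r₂ u|) + μ₁ * (∫ u, |u| * |r₁ u|) ≤ μ₁ * M := by
      rw [← mul_add]; exact mul_le_mul_of_nonneg_left l11 hμ₁p.le
    linarith only [S1m1, h1, h2, f1]
  have bS1Kd : ∫ t, |kS1' t| ≤ 8 * π * M / √q := by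
    rw [U2md, S0md] at S1md
    have h1 : μ₁⁻¹ * (∫ u, |r₁' u|) ≤ μ₂⁻¹ * (∫ u, |r₁' u|) := mul_le_mul_of_nonneg_right (inv_anti₀ hμ₂p hμ21) n03
    have h2 : μ₂⁻¹ * (∫ u, |r₂' u|) + μ₂⁻¹ * (∫ u, |r₁' u|) ≤ μ₂⁻¹ * M := by
      rw [← mul_add]; exact mul_le_mul_of_nonneg_left l12 (inv_pos.2 hμ₂p).le
    linarith only [S1md, h1, h2, f2i]
  have bS1Kd1 : ∫ t, |t| * |kS1' t| ≤ 8 * π * M := by rw [U2md1, S0md1] at S1md1; linarith only [S1md1, l13, fM]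
  have bKa : ∫ t, |ka t| ≤ 8 * π * M := by rw [am0]; linarith only [l18, fM]
  have bKa1 : ∫ t, |t| * |ka t| ≤ 8 * π * M * √q := by rw [am1]; exact (mul_le_mul_of_nonneg_left l19 hμ₂p.le).trans f2
  have bKad1 : ∫ t, |t| * |ka' t| ≤ 8 * π * M := by rw [amd1]; linarith only [l20, fM]
  have bKb : ∫ t, |kb t| ≤ 8 * π * M := by rw [bm0]; linarith only [l21, fM]
  have bKb1 : ∫ t, |t| * |kb t| ≤ 8 * π * M * √q := by rw [bm1]; exact (mul_le_mul_of_nonneg_left l22 hμ₂p.le).trans f2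
  have bKbd1 : ∫ t, |t| * |kb' t| ≤ 8 * π * M := by rw [bmd1]; linarith only [l23, fM]
  have bMK : ∫ t, |kM t| ≤ 8 * π * M := by rw [Nm0, U3m0] at Mm0; linarith only [Mm0, l14, fM]
  have bMK1 : ∫ t, |t| * |kM t| ≤ 8 * π * M * √q := by
    rw [Nm1, U3m1] at Mm1
    have h1 : μ₄ * (∫ u, |u| * |r₁ u|) ≤ μ₂ * (∫ u, |u| * |r₁ u|) := mul_le_mul_of_nonneg_right hμ42 n02
    have h2 : μ₂ * (∫ u, |u| * |r₁ u|) + μ₂ * (∫ u, |u| * |r₃ u|) ≤ μ₂ * M := by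
      rw [← mul_add]; exact mul_le_mul_of_nonneg_left l15 hμ₂p.le
    linarith only [Mm1, h1, h2, f2]
  have bMKd : ∫ t, |kM' t| ≤ 8 * π * M * X / √q := by
    rw [Nmd, U3md] at Mmd
    have h1 : μ₂⁻¹ * (∫ u, |r₃' u|) ≤ μ₄⁻¹ * (∫ u, |r₃' u|) := mul_le_mul_of_nonneg_right (inv_anti₀ hμ₄p hμ42) n16
    have h2 : μ₄⁻¹ * (∫ u, |r₁' u|) + μ₄⁻¹ * (∫ u, |r₃' u|) ≤ μ₄⁻¹ * M := by
      rw [← mul_add]; exact mul_le_mul_of_nonneg_left l16 (inv_pos.2 hμ₄p).le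
    linarith only [Mmd, h1, h2, f4i]
  have bMKd1 : ∫ t, |t| * |kM' t| ≤ 8 * π * M := by rw [Nmd1, U3md1] at Mmd1; linarith only [Mmd1, l17, fM]
  have bNK : ∫ t, |kN t| ≤ 8 * π * M := by rw [Nm0]; linarith only [l01, fM]
  have bNK1 : ∫ t, |t| * |kN t| ≤ 8 * π * M * √q / X := by rw [Nm1]; exact (mul_le_mul_of_nonneg_left l02 hμ₄p.le).trans f4
  have bNKd2 : ∫ t, t ^ 2 * |kN' t| ≤ 8 * π * M * √q / X := by rw [Nmd2]; exact (mul_le_mul_of_nonneg_left l05 hμ₄p.le).trans f4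
  have bTM : ∫ t, |t * kN' t + kN t| ≤ 8 * π * M := by rw [NmT]; linarith only [l06, fM]
  have bTM1 : ∫ t, |t| * |t * kN' t + kN t| ≤ 8 * π * M * √q / X := by
    rw [NmT1]; exact (mul_le_mul_of_nonneg_left l07 hμ₄p.le).trans f4
  have bTMd : ∫ t, |2 * kN' t + t * kN'' t| ≤ 8 * π * M * X / √q := by
    rw [NmTd]; exact (mul_le_mul_of_nonneg_left l08 (inv_pos.2 hμ₄p).le).trans f4i
  have bTMd1 : ∫ t, |t| * |2 * kN' t + t * kN'' t| ≤ 8 * π * M := by rw [NmTd1]; linarith only [l09, fM]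
  /- §6 the model theorem -/
  have hκS1 : 0 < 2 / q * (xs ^ 2 / 16 * Real.log (2 / xs)) := by
    have hlog : 0 < Real.log (2 / xs) := Real.log_pos (by rw [lt_div_iff₀ hxs]; linarith only [hxs'])
    exact mul_pos (div_pos two_pos hq) (mul_pos (div_pos (pow_pos hxs 2) (by norm_num)) hlog)
  have hκM : (0 : ℝ) < 2 / q * (1 / 50) := mul_pos (div_pos two_pos hq) (by norm_num)
  have hσ₀ : (0 : ℝ) < 153 / 4000 := by norm_num
  exact model_l2_estimate hq hG hR hxs hxs' hX0 hκS1 hκM hσ₀ hθ hη hβ₀ hY hYs hYR hw hw2 hΛ hΛ₂ hwc hβ₁c hb₁ hL₁ hβ₂ hβ₂'c hb₂ hL₂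
    hgrowth S0d S0c' S0i S0di S0i1 S0di1 S0B hS0supp S1d S1c' S1i S1di S1i1 S1di1 S1B hS1sym
    ad ac' ai adi ai1 adi1 aB bd bc' bi bdi bi1 bdi1 bB aev bodd hband Md Mc' Mi Mdi Mi1 Mdi1 MB hMsym
    Nd Nd' Nc'' Ni Ndi Ni1 Ndi1 Ndi2 Nddi1 Nddi2 NB NTB hNfar hTsym hsum'
    bS0K bS0K1 bS0Kd1 bS1K bS1K1 bS1Kd bS1Kd1 bKa bKa1 bKad1 bKb bKb1 bKbd1 bMK bMK1 bMKd bMKd1 bNK bNK1 bNKd2 bTM bTM1 bTMd bTMd1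
    egS0 eε hε1 eℓ ecH eCF eRW eαT eδT eα₁ eδ₁ eα₂ eδ₂ eα₃ eδ₃ eα₅ eδ₅ eα₆ eδ₆ hδ

end Summit.NavierStokesRegularity.NavierStokesRegularity.Theorems.MatchedKernel

end
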